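/-
Copyright (c) 2026 the pub-hodgecm-mathlib formalisation cell (harness21).  Prover seat hodgecm-mathlib-K2Liu-p09 (g2): Track B «K2-LIT»,
#184♮ = hLiu418 = stmt-HodgeConjecture-24832, unit U5b «LOCAL SEAM OF s23»: SOCKET #29s `sig_K2LiuDoublingPartialEuler` PAID BY NAME; 2026-09-04.
-/
import Summits.HodgeConjecture.HodgeConjecture.Theorems.K2LiuDoublingHaarPinned             -- ★ (C0a): pinned splitting of the Haar measure
import Summits.HodgeConjecture.HodgeConjecture.Theorems.K2LiuDoublingEulerLimit             -- ★ (C0c): transport, slices, box limit, cases (+ ★ (C0b), ★ (A))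
import Summits.HodgeConjecture.HodgeConjecture.Theorems.K2LiuQuotMatrixCoeffContinuous      -- ★ (B): continuity + bound of `⟨π(g)φ₁, φ₂⟩`
import Literature.NumberTheory.K2Lit.LocalDoublingZeta                                      -- ★ D7b: `localZeta`, `placesEmbed`, `zetaS`, `ZetaSConverges`
import HarnessLib

/-!
# Crux `HLiu418`, Track B road `K2_Liu`, unit U5b «LOCAL SEAM OF s23»:
# SOCKET #29s `sig_K2LiuDoublingPartialEuler` — EULER FACTORISATION OF THE DOUBLING ZETA INTEGRAL OFF `S`:
# `Z = (∏'_{v∉S} c_v) · Z_S`, PAID BY NAME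

Cell `hodgecm-mathlib`, crux item hLiu418 = `stmt-HodgeConjecture-24832`; squad K2 ∕ K2Liu, prover K2Liu-p09 (g2).  THEOREMS ONLY; lane
`--supports stmt-HodgeConjecture-24832` (socket #29s of `Cruxes/HLiu418/Lines/K2_Liu_CurveThetaSigs_U5b_LocalSeam.lean` ED. 5 :235, type VERBATIM; LEAD F0P6-plan
re-deal 2026-09-04T01:20:48Z, REPORT-FIRST `K2/K2Liu-p09/g2/REPORT-FIRST-29s-DoublingPartialEuler.K2Liup09g2.md` «=» 01:30:25Z).

THE STATEMENT (Liu 2011 §2B Prop. 2.3 in Hecke form; Piatetski-Shapiro–Rallis Part A §1; Tate's Theorem 3.3.1 with a vector twist).  For the `H`-side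
datum (`𝒢 = U(H)`, bridge `ιA : U(H)(𝔸) →* U(diag dV)(𝔸)`), a finite set `S` of finite places, a Haar measure `ν` on `G(𝔸)` and local Haar measures `ν_v`
with `ν_v(K_v) = 1` off `S`: THERE IS a Haar measure `ν_∞` on `G_∞` (depending on `ν, (ν_v), S` only) such that for every automorphic measure `μ` on the compact
quotient `[G]`, section `f`, continuous `φ₁ φ₂`, and data `FS, Λ_v, c_v` with (F) factorisation of the pulled-back section off `S`, (Λ) `Λ_v|K_v = 1`,
`Λ_v ∈ L¹(ν_v)`, bounded partial products, (I) continuity + integrability of the pulled-back section, (K) `K^S`-sphericity of the matrix coefficient and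
(E) the local doubling-Hecke identities at every `v ∉ S`:  `Z_S` converges absolutely and `Z = (∏'_{v∉S} c_v) · Z_S`.

THE PROOF.  (T0) ★ (C0a): `(g ↦ (g_∞, g_S, g^S))_* ν = ν_∞ ⊗ (⊗_{v∈S} ν_v) ⊗ ∏'_{v∉S}(ν_v; K_v)` — THIS `ν_∞` is the witness.  (T1) Fubini along the
splitting (★ p04 `integral_eq_integral_integral_off`): `Z = ∫_X ∫_Y F₀((x_∞,1)(1,ι_S x_S)(1,ι^S y)) dy dx` with `F₀ = (f∘ι∘ιA)·Q`, `Q = ⟨π(·)φ₁, φ₂⟩` bounded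
and continuous (★ (B)); the glued integrand is integrable on `X × Y` (★ (C0c) `integrable_glue_of_map_eq`).  (T2) ★ (C0c) slice box formula:
`∫_{A_T} F₀(…) dy = f(ι ιA pe x)·Q(pe x)·∏_{v∈T} c_v` (`pe x = (x_∞,1)(1,ι_S x_S)` = ★ `placesEmbed S x`).  (T3) for a.e. `x` the slice is integrable (Fubini), so
the box integrals converge to the full `Y`-integral along `T ↑` (★ (C0c) `tendsto_of_setIntegral_rpBox_eq`).  (T4) ★ (C0c) «MULTIPLIABILITY BY CASES»
`integral_eq_tprod_mul_integral_of_tendsto`.  (T5) `ZetaSConverges`: the slice at some `y₀` of the mass-one box `A_∅` (★ `rpMeasure_rpBox_empty`,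
★ `exists_mem_integrable_slice`) is integrable in `x`, and it IS `h` (★ `slice_eq_of_forall_mem`).
[Tate, Cassels–Fröhlich Ch. XV §3.3 Thm 3.3.1; Liu (2011) §2B Prop. 2.3 p. 862; Piatetski-Shapiro–Rallis LNM 1254 Part A §1, §6; Li (1992) §3; Borel–Jacquet (1979) §4.1.]

DEGENERATE CORNERS.  `S = ∅` ✓ (`G_S` is a point); `N = 0` ✓; `⟨π(·)φ₁, φ₂⟩ ≡ 0` ✓ (both sides `0`, `∏'` unconstrained); the bound `B` of hypothesis (Λ) is not
used (integrability comes from (I) by Fubini) — it is carried as the socket states it; `νinf` is produced BEFORE `μ, ιA, f, …` as the binder order demands.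

HONEST LABEL.  This file pays socket #29s of the U5b line; by itself it retires no named input: `HC_CM` is proved only modulo the 7 printed citations
(2 remaining named inputs: hLiu418 = `stmt-HodgeConjecture-24832`, h413 = `stmt-HodgeConjecture-24833`) until rung 0 closes.
-/

set_option autoImplicit false
-- the mandated namespace repeats the single-problem summit's segment (`HodgeConjecture.HodgeConjecture`)
set_option linter.dupNamespace false

noncomputable section

open scoped RestrictedProduct ENNReal NNReal Topology
open NumberField IsDedekindDomain MeasureTheory Measure Filter

namespace Summit.HodgeConjecture.HodgeConjecture.Cruxes.HLiu418.K2LiuDoublingPartialEuler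

open Literature.NumberTheory.Automorphic Literature.NumberTheory.GaloisRepresentations
open Literature.NumberTheory.GelbartRogawski1991 Literature.NumberTheory.GelbartRogawski1991.GRConstruction
open Literature.NumberTheory.K2Lit.SiegelDoubled Literature.NumberTheory.K2Lit.PlaceSplitting
open Literature.MeasureTheory.RestrictedProduct
open Summit.HodgeConjecture.HodgeConjecture.Cruxes.HLiu418.K2LiuAdelicPlaceSplittingFubini
open Summit.HodgeConjecture.HodgeConjecture.Cruxes.HLiu418.K2LiuDoublingZetaPlaceSplitting
open Summit.HodgeConjecture.HodgeConjecture.Cruxes.HLiu418.K2LiuDoublingHaarPinned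
open Summit.HodgeConjecture.HodgeConjecture.Cruxes.HLiu418.K2LiuDoublingEulerBox
open Summit.HodgeConjecture.HodgeConjecture.Cruxes.HLiu418.K2LiuDoublingEulerLimit
open Summit.HodgeConjecture.HodgeConjecture.Cruxes.HLiu418.K2LiuQuotMatrixCoeffContinuous

/-! ## §1 Generic core: `∫ F₀ dν = (∏' c) · ∫ h` and the integrability of `h`, for a pinned splitting -/

section Generic

variable (F E : Type) [Field F] [NumberField F] [Field E] [NumberField E] [Algebra F E]
  (c : E ≃ₐ[F] E) (N : ℕ) (J : Matrix (Fin N) (Fin N) E)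
  (S : Finset (HeightOneSpectrum (𝓞 F))) [DecidableEq (HeightOneSpectrum (𝓞 F))]
  [MeasurableSpace (UnitaryGroup.adelicGroupData F E c N J).Adelic] [BorelSpace (UnitaryGroup.adelicGroupData F E c N J).Adelic] [MeasurableSpace (UnitaryGroup.arch F E c N J)] [BorelSpace (UnitaryGroup.arch F E c N J)]
  [∀ v : HeightOneSpectrum (𝓞 F), MeasurableSpace (UnitaryGroup.localPi E c N J v)] [∀ v : HeightOneSpectrum (𝓞 F), BorelSpace (UnitaryGroup.localPi E c N J v)]

set_option maxHeartbeats 800000 in -- measured: ≤ 800 000, > default (Fubini ∕ box-limit assembly over `G_∞ × G_S × ∏'_{v∉S}`); no search tactics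
/-- **GENERIC CORE of socket #29s.**  For a pinned splitting `(g ↦ (g_∞, g_S, g^S))_* ν = ν_∞ ⊗ (⊗_{v∈S} ν_v) ⊗ ∏'_{v∉S}(ν_v; K_v)`, continuous `φ, Q` on `U(J)(𝔸_F)`
with `φ·Q ∈ L¹(ν)`, `Q` bounded with the invariance (K), `φ` of shape (F) with `Λ_v|K_v = 1`, `Λ_v ∈ L¹(ν_v)`, and the local Hecke identities (E) off `S`:
the function `h(x) = φ(pe x)·Q(pe x)` (`pe x = (x_∞,1)(1,ι_S x_S)`) is integrable for `ν_∞ ⊗ ⊗_{v∈S} ν_v`, and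
`∫ φ·Q dν = (∏'_{v∉S} c_v) · ∫ h d(ν_∞ ⊗ ⊗_{v∈S} ν_v)` — steps (T1)–(T5) of the module docstring.
[cite: CasselsFrohlichANT1967, Ch. XV (Tate) §3.3 Thm. 3.3.1] [cite: Liu2011, §2B Prop. 2.3 p. 862] [cite: GelbartPiatetskishapiroRallis1987, Part A §1] -/
theorem integrable_and_integral_eq_tprod_mul_of_map_eq
    (ν : Measure (UnitaryGroup.adelicGroupData F E c N J).Adelic) (νv : ∀ v : HeightOneSpectrum (𝓞 F), Measure (UnitaryGroup.localPi E c N J v)) [∀ v, (νv v).IsHaarMeasure]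
    (hνK : ∀ v, v ∉ S → νv v (UnitaryGroup.localInt E c N J v : Set (UnitaryGroup.localPi E c N J v)) = 1)
    (νinf : Measure (UnitaryGroup.arch F E c N J)) [SigmaFinite νinf]
    (hmap : Measure.map (fun g => (UnitaryGroup.archPart F E c N J g, (splitPlaces F E c N J S) (UnitaryGroup.finPart F E c N J g))) ν =
      νinf.prod ((Measure.pi fun v : S => νv v.1).prod (rpMeasure (fun v : {v : HeightOneSpectrum (𝓞 F) // v ∉ S} => (UnitaryGroup.localInt E c N J v.1 : Set (UnitaryGroup.localPi E c N J v.1))) (fun v => νv v.1) ∅)))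
    (φ Q : (UnitaryGroup.adelicGroupData F E c N J).Adelic → ℂ) (hφc : Continuous φ) (hQc : Continuous Q) {CQ : ℝ} (hQb : ∀ g, ‖Q g‖ ≤ CQ)
    (hint : Integrable (fun g => φ g * Q g) ν)
    (hK : ∀ t k : (UnitaryGroup.adelicGroupData F E c N J).Adelic, UnitaryGroup.archPart F E c N J k = 1 → (∀ v, UnitaryGroup.evalPlace F E c N J v (UnitaryGroup.finPart F E c N J k) ∈ UnitaryGroup.localInt E c N J v) → (∀ v ∈ S, UnitaryGroup.evalPlace F E c N J v (UnitaryGroup.finPart F E c N J k) = 1) →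
      Q (t * k) = Q t)
    (FS : (UnitaryGroup.arch F E c N J) × (Π v : S, UnitaryGroup.localPi E c N J v.1) → ℂ) (Λ : ∀ v : HeightOneSpectrum (𝓞 F), UnitaryGroup.localPi E c N J v → ℂ) (cv : HeightOneSpectrum (𝓞 F) → ℂ)
    (hF : ∀ t : (UnitaryGroup.adelicGroupData F E c N J).Adelic, φ t = FS (UnitaryGroup.archPart F E c N J t, fun v : S => UnitaryGroup.evalPlace F E c N J v.1 (UnitaryGroup.finPart F E c N J t)) * ∏ᶠ v : {v : HeightOneSpectrum (𝓞 F) // v ∉ S}, Λ v.1 (UnitaryGroup.evalPlace F E c N J v.1 (UnitaryGroup.finPart F E c N J t)))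
    (hΛK : ∀ v, v ∉ S → ∀ k ∈ UnitaryGroup.localInt E c N J v, Λ v k = 1)
    (hΛint : ∀ v, v ∉ S → Integrable (Λ v) (νv v))
    (hE : ∀ v, v ∉ S → ∀ t : (UnitaryGroup.adelicGroupData F E c N J).Adelic, ∫ g, Λ v g * Q (t * UnitaryGroup.inclPlaceAdelic F E c N J v g) ∂(νv v) = cv v * Q t) :
    Integrable (fun x : (UnitaryGroup.arch F E c N J) × (Π v : S, UnitaryGroup.localPi E c N J v.1) => φ (UnitaryGroup.archToAdelic F E c N J x.1 * UnitaryGroup.finAdelicToAdelic F E c N J ((splitPlaces F E c N J S).symm (x.2, 1))) * Q (UnitaryGroup.archToAdelic F E c N J x.1 * UnitaryGroup.finAdelicToAdelic F E c N J ((splitPlaces F E c N J S).symm (x.2, 1)))) (νinf.prod (Measure.pi fun v : S => νv v.1)) ∧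
      ∫ g, φ g * Q g ∂ν = (∏' v : {v : HeightOneSpectrum (𝓞 F) // v ∉ S}, cv v.1) *
        ∫ x : (UnitaryGroup.arch F E c N J) × (Π v : S, UnitaryGroup.localPi E c N J v.1), φ (UnitaryGroup.archToAdelic F E c N J x.1 * UnitaryGroup.finAdelicToAdelic F E c N J ((splitPlaces F E c N J S).symm (x.2, 1))) * Q (UnitaryGroup.archToAdelic F E c N J x.1 * UnitaryGroup.finAdelicToAdelic F E c N J ((splitPlaces F E c N J S).symm (x.2, 1))) ∂(νinf.prod (Measure.pi fun v : S => νv v.1)) := by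
  -- §0 instances
  haveI : Countable (HeightOneSpectrum (𝓞 F)) := countable_heightOneSpectrum F
  haveI : ∀ v, SecondCountableTopology (UnitaryGroup.localPi E c N J v) := fun v => UnitaryGroup.secondCountableTopology_localPi E N c J v
  haveI : ∀ v, LocallyCompactSpace (UnitaryGroup.localPi E c N J v) := fun v => UnitaryGroup.locallyCompactSpace_localPi E N c J v
  haveI := fact_isOpen_off (fun v => UnitaryGroup.localPi E c N J v) (fun v => UnitaryGroup.localInt E c N J v) S
  haveI := borelSpace_off (fun v => UnitaryGroup.localPi E c N J v) (fun v => UnitaryGroup.localInt E c N J v) S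
  haveI := secondCountableTopology_off (fun v => UnitaryGroup.localPi E c N J v) (fun v => UnitaryGroup.localInt E c N J v) S
  haveI : ∀ v, SigmaFinite (νv v) := fun v => inferInstance
  obtain ⟨-, hσrp⟩ := isHaarMeasure_rpMeasure_localPi F E c N J S νv hνK
  haveI := hσrp
  have hKne : ∀ v : {v : HeightOneSpectrum (𝓞 F) // v ∉ S}, ((fun v : {v : HeightOneSpectrum (𝓞 F) // v ∉ S} => (UnitaryGroup.localInt E c N J v.1 : Set (UnitaryGroup.localPi E c N J v.1))) v).Nonempty := fun v => ⟨1, (UnitaryGroup.localInt E c N J v.1).one_mem⟩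
  have hKm : ∀ v : {v : HeightOneSpectrum (𝓞 F) // v ∉ S}, MeasurableSet ((fun v : {v : HeightOneSpectrum (𝓞 F) // v ∉ S} => (UnitaryGroup.localInt E c N J v.1 : Set (UnitaryGroup.localPi E c N J v.1))) v) := fun v => (UnitaryGroup.isOpen_localInt E c N J v.1).measurableSet
  have hQm : Measurable Q := hQc.measurable
  have hF₀c : Continuous fun g => φ g * Q g := hφc.mul hQc
  -- names: the finite-place product `piS`, the restricted product `rpM`, the integrand `h` of `Z_S`
  obtain ⟨piS, hpiS⟩ : ∃ piS : Measure (Π v : S, UnitaryGroup.localPi E c N J v.1), piS = Measure.pi fun v : S => νv v.1 := ⟨_, rfl⟩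
  obtain ⟨rpM, hrpM⟩ : ∃ rpM : Measure (Πʳ v : {v : HeightOneSpectrum (𝓞 F) // v ∉ S}, [UnitaryGroup.localPi E c N J v.1, UnitaryGroup.localInt E c N J v.1]), rpM = rpMeasure (fun v : {v : HeightOneSpectrum (𝓞 F) // v ∉ S} => (UnitaryGroup.localInt E c N J v.1 : Set (UnitaryGroup.localPi E c N J v.1))) (fun v => νv v.1) ∅ := ⟨_, rfl⟩
  haveI : SigmaFinite piS := by rw [hpiS]; infer_instance
  haveI : SigmaFinite rpM := by rw [hrpM]; infer_instance
  rw [← hpiS, ← hrpM] at hmap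
  rw [← hpiS]
  obtain ⟨h, hh⟩ : ∃ h : (UnitaryGroup.arch F E c N J) × (Π v : S, UnitaryGroup.localPi E c N J v.1) → ℂ, ∀ x, h x = φ (UnitaryGroup.archToAdelic F E c N J x.1 * UnitaryGroup.finAdelicToAdelic F E c N J ((splitPlaces F E c N J S).symm (x.2, 1))) * Q (UnitaryGroup.archToAdelic F E c N J x.1 * UnitaryGroup.finAdelicToAdelic F E c N J ((splitPlaces F E c N J S).symm (x.2, 1))) := ⟨_, fun _ => rfl⟩
  simp_rw [← hh]
  -- (T1) Fubini along the pinned splitting (★ p04) and the integrability of the glued integrand (★ (C0c))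
  have hT1 := integral_eq_integral_integral_off F E c N J S ν hmap (fun g => φ g * Q g) hint
  have hGint := integrable_glue_of_map_eq F E c N J S ν νinf piS rpM hmap (fun g => φ g * Q g) hF₀c hint
  -- (T2) the slice box formula (★ (C0c)) and (T3) the box limit on integrable slices
  have hbox : ∀ (x : (UnitaryGroup.arch F E c N J) × (Π v : S, UnitaryGroup.localPi E c N J v.1)) (T : Finset {v : HeightOneSpectrum (𝓞 F) // v ∉ S}),
      ∫ y in rpBox (fun v : {v : HeightOneSpectrum (𝓞 F) // v ∉ S} => (UnitaryGroup.localInt E c N J v.1 : Set (UnitaryGroup.localPi E c N J v.1))) T, φ (UnitaryGroup.archToAdelic F E c N J x.1 * UnitaryGroup.finAdelicToAdelic F E c N J ((splitPlaces F E c N J S).symm (x.2, 1)) * UnitaryGroup.finAdelicToAdelic F E c N J ((splitPlaces F E c N J S).symm (1, y))) * Q (UnitaryGroup.archToAdelic F E c N J x.1 * UnitaryGroup.finAdelicToAdelic F E c N J ((splitPlaces F E c N J S).symm (x.2, 1)) * UnitaryGroup.finAdelicToAdelic F E c N J ((splitPlaces F E c N J S).symm (1, y))) ∂rpM = h x * ∏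 v ∈ T, cv v.1 := by
    intro x T
    rw [hh, hrpM]
    exact setIntegral_rpBox_slice F E c N J S φ Q hQm hQb hK νv hνK FS Λ hF hΛK hΛint cv hE x T
  have hlim : ∀ x : (UnitaryGroup.arch F E c N J) × (Π v : S, UnitaryGroup.localPi E c N J v.1), Integrable (fun y => φ (UnitaryGroup.archToAdelic F E c N J x.1 * UnitaryGroup.finAdelicToAdelic F E c N J ((splitPlaces F E c N J S).symm (x.2, 1)) * UnitaryGroup.finAdelicToAdelic F E c N J ((splitPlaces F E c N J S).symm (1, y))) * Q (UnitaryGroup.archToAdelic F E c N J x.1 * UnitaryGroup.finAdelicToAdelic F E c N J ((splitPlaces F E c N J S).symm (x.2, 1)) * UnitaryGroup.finAdelicToAdelic F E c N J ((splitPlaces F E c N J S).symm (1, y)))) rpM →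
      Tendsto (fun T : Finset {v : HeightOneSpectrum (𝓞 F) // v ∉ S} => h x * ∏ v ∈ T, cv v.1) atTop (𝓝 (∫ y, φ (UnitaryGroup.archToAdelic F E c N J x.1 * UnitaryGroup.finAdelicToAdelic F E c N J ((splitPlaces F E c N J S).symm (x.2, 1)) * UnitaryGroup.finAdelicToAdelic F E c N J ((splitPlaces F E c N J S).symm (1, y))) * Q (UnitaryGroup.archToAdelic F E c N J x.1 * UnitaryGroup.finAdelicToAdelic F E c N J ((splitPlaces F E c N J S).symm (x.2, 1)) * UnitaryGroup.finAdelicToAdelic F E c N J ((splitPlaces F E c N J S).symm (1, y))) ∂rpM)) := by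
    intro x hx
    rw [hrpM] at hx ⊢
    exact tendsto_of_setIntegral_rpBox_eq (fun v : {v : HeightOneSpectrum (𝓞 F) // v ∉ S} => (UnitaryGroup.localInt E c N J v.1 : Set (UnitaryGroup.localPi E c N J v.1))) (fun v => νv v.1) hKm hx (fun T => by rw [← hrpM]; exact hbox x T)
  have hae : ∀ᵐ x ∂(νinf.prod piS), Integrable (fun y => φ (UnitaryGroup.archToAdelic F E c N J x.1 * UnitaryGroup.finAdelicToAdelic F E c N J ((splitPlaces F E c N J S).symm (x.2, 1)) * UnitaryGroup.finAdelicToAdelic F E c N J ((splitPlaces F E c N J S).symm (1, y))) * Q (UnitaryGroup.archToAdelic F E c N J x.1 * UnitaryGroup.finAdelicToAdelic F E c N J ((splitPlaces F E c N J S).symm (x.2, 1)) * UnitaryGroup.finAdelicToAdelic F E c N J ((splitPlaces F E c N J S).symm (1, y)))) rpM := hGint.prod_right_ae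
  refine ⟨?_, ?_⟩
  · -- (T5) `h` is integrable: the slice at a point of the mass-one box `A_∅` is `h`
    have hbox0 : rpM (rpBox (fun v : {v : HeightOneSpectrum (𝓞 F) // v ∉ S} => (UnitaryGroup.localInt E c N J v.1 : Set (UnitaryGroup.localPi E c N J v.1))) ∅) ≠ 0 := by
      rw [hrpM, rpMeasure_rpBox_empty (fun v : {v : HeightOneSpectrum (𝓞 F) // v ∉ S} => (UnitaryGroup.localInt E c N J v.1 : Set (UnitaryGroup.localPi E c N J v.1))) (fun v => νv v.1) hKne hKm (fun v => hνK v.1 v.2)]; exact one_ne_zero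
    obtain ⟨y₀, hy₀, hint₀⟩ := exists_mem_integrable_slice hGint (measurableSet_rpBox (fun v : {v : HeightOneSpectrum (𝓞 F) // v ∉ S} => (UnitaryGroup.localInt E c N J v.1 : Set (UnitaryGroup.localPi E c N J v.1))) hKm ∅) hbox0
    have hy₀K : ∀ v : {v : HeightOneSpectrum (𝓞 F) // v ∉ S}, y₀ v ∈ UnitaryGroup.localInt E c N J v.1 := fun v => hy₀ v (Finset.notMem_empty v)
    refine hint₀.congr (Eventually.of_forall fun x => ?_)
    dsimp only
    rw [slice_eq_of_forall_mem F E c N J S φ Q hK FS Λ hF hΛK x y₀ hy₀K, hh]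
  · -- (T4) multipliability by cases, then the identity
    rw [hT1]
    exact integral_eq_tprod_mul_integral_of_tendsto _ h (fun v : {v : HeightOneSpectrum (𝓞 F) // v ∉ S} => cv v.1) hae hlim

end Generic

/-! ## §2 The socket -/

set_option maxHeartbeats 1600000 in -- measured: fails at 800 000, passes at 1 600 000 (the socket's own CM-datum statement, cf. U5b's 2 000 000); no search
/-- **SOCKET #29s `sig_K2LiuDoublingPartialEuler` (type verbatim): `Z = (∏'_{v∉S} c_v) · Z_S` for a section factorizable off `S` against a `K^S`-spherical
vector that is a local doubling-Hecke eigenvector at every `v ∉ S`, together with the absolute convergence of `Z_S`.**  The witness `ν_∞` is the archimedean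
factor of the PINNED splitting of `ν` (★ (C0a)), so it depends on `(ν, (ν_v), S)` only; `Q = ⟨π(·)φ₁, φ₂⟩` is bounded and continuous (★ (B)); the rest is the
generic core `integrable_and_integral_eq_tprod_mul_of_map_eq` read through ★ `placesEmbed S x = (x_∞,1)(1,ι_S x_S)` (`rfl`).
[cite: CasselsFrohlichANT1967, Ch. XV (Tate) §3.3 Thm. 3.3.1] [cite: Liu2011, §2B Prop. 2.3 p. 862] [cite: GelbartPiatetskishapiroRallis1987, Part A §1, §6]
[cite: Li1992, §3 Thm. 3.1] [cite: BorelJacquet1979, §4.1] -/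
theorem doublingPartialEuler :
    ∀ (L : Type) [Field L] [NumberField L] [IsCMField L] {N M n : ℕ} (e : Fin N × Fin M ≃ Fin n)
      (dV : Fin N → L) (hdV : ∀ i, IsCMField.complexConj L (dV i) = dV i)
      (dW : Fin M → L) (hdW : ∀ i, IsCMField.complexConj L (dW i) = dW i)
      (H : Matrix (Fin N) (Fin N) L)
      (S : Finset (HeightOneSpectrum (𝓞 (Fp L)))) [DecidableEq (HeightOneSpectrum (𝓞 (Fp L)))]
      [MeasurableSpace (UnitaryGroup.adelicGroupData (Fp L) L (IsCMField.complexConj L) N H).Adelic]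
      [BorelSpace (UnitaryGroup.adelicGroupData (Fp L) L (IsCMField.complexConj L) N H).Adelic]
      [MeasurableSpace (UnitaryGroup.arch (Fp L) L (IsCMField.complexConj L) N H)]
      [BorelSpace (UnitaryGroup.arch (Fp L) L (IsCMField.complexConj L) N H)]
      [∀ v : HeightOneSpectrum (𝓞 (Fp L)), MeasurableSpace (UnitaryGroup.localPi L (IsCMField.complexConj L) N H v)]
      [∀ v : HeightOneSpectrum (𝓞 (Fp L)), BorelSpace (UnitaryGroup.localPi L (IsCMField.complexConj L) N H v)]
      (ν : Measure (UnitaryGroup.adelicGroupData (Fp L) L (IsCMField.complexConj L) N H).Adelic) [ν.IsHaarMeasure]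
      (νv : ∀ v : HeightOneSpectrum (𝓞 (Fp L)), Measure (UnitaryGroup.localPi L (IsCMField.complexConj L) N H v))
      [∀ v, (νv v).IsHaarMeasure]
      (_hνK : ∀ v, v ∉ S →
        νv v (UnitaryGroup.localInt L (IsCMField.complexConj L) N H v : Set (UnitaryGroup.localPi L (IsCMField.complexConj L) N H v)) = 1),
      ∃ νinf : Measure (UnitaryGroup.arch (Fp L) L (IsCMField.complexConj L) N H), νinf.IsHaarMeasure ∧
        ∀ (μ : Measure (UnitaryGroup.adelicGroupData (Fp L) L (IsCMField.complexConj L) N H).automorphicQuotient)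
          [(UnitaryGroup.adelicGroupData (Fp L) L (IsCMField.complexConj L) N H).IsAutomorphicMeasure μ]
          [CompactSpace (UnitaryGroup.adelicGroupData (Fp L) L (IsCMField.complexConj L) N H).automorphicQuotient]
          (ιA : (UnitaryGroup.adelicGroupData (Fp L) L (IsCMField.complexConj L) N H).Adelic →*
            UnitaryGroup.adelic (Fp L) L (IsCMField.complexConj L) N (Matrix.diagonal dV))
          (f : HA L e dV hdV dW hdW → ℂ)
          (φ₁ φ₂ : (UnitaryGroup.adelicGroupData (Fp L) L (IsCMField.complexConj L) N H).automorphicQuotient → ℂ)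
          (_hφ₁ : Continuous φ₁) (_hφ₂ : Continuous φ₂)
          (FS : UnitaryGroup.arch (Fp L) L (IsCMField.complexConj L) N H ×
              (Π v : S, UnitaryGroup.localPi L (IsCMField.complexConj L) N H v.1) → ℂ)
          (Λ : ∀ v : HeightOneSpectrum (𝓞 (Fp L)), UnitaryGroup.localPi L (IsCMField.complexConj L) N H v → ℂ)
          (c : HeightOneSpectrum (𝓞 (Fp L)) → ℂ)
          -- (F) factorisation of the pulled-back section off `S`
          (_hF : ∀ t : (UnitaryGroup.adelicGroupData (Fp L) L (IsCMField.complexConj L) N H).Adelic,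
            f (iotaLeft L e dV hdV dW hdW (ιA t)) =
              FS (UnitaryGroup.archPart (Fp L) L (IsCMField.complexConj L) N H t,
                  fun v : S => UnitaryGroup.evalPlace (Fp L) L (IsCMField.complexConj L) N H v.1
                    (UnitaryGroup.finPart (Fp L) L (IsCMField.complexConj L) N H t)) *
                ∏ᶠ v : {v : HeightOneSpectrum (𝓞 (Fp L)) // v ∉ S},
                  Λ v.1 (UnitaryGroup.evalPlace (Fp L) L (IsCMField.complexConj L) N H v.1
                    (UnitaryGroup.finPart (Fp L) L (IsCMField.complexConj L) N H t)))
          -- (Λ) unramified normalisation, local integrability, bounded partial Euler products of `∫|Λ_v|`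
          (_hΛK : ∀ v, v ∉ S → ∀ k ∈ UnitaryGroup.localInt L (IsCMField.complexConj L) N H v, Λ v k = 1)
          (_hΛint : ∀ v, v ∉ S → Integrable (Λ v) (νv v))
          (_hΛbd : ∃ B : ℝ, ∀ T : Finset {v : HeightOneSpectrum (𝓞 (Fp L)) // v ∉ S},
            ∏ v ∈ T, ∫ g, ‖Λ v.1 g‖ ∂(νv v.1) ≤ B)
          -- (I) the pulled-back section is continuous and integrable along `G(𝔸)`
          (_hfc : Continuous fun t => f (iotaLeft L e dV hdV dW hdW (ιA t)))
          (_hfi : Integrable (fun t => f (iotaLeft L e dV hdV dW hdW (ιA t))) ν)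
          -- (K) `K^S`-sphericity of slot 1
          (_hK : ∀ t k : (UnitaryGroup.adelicGroupData (Fp L) L (IsCMField.complexConj L) N H).Adelic,
            UnitaryGroup.archPart (Fp L) L (IsCMField.complexConj L) N H k = 1 →
            (∀ v, UnitaryGroup.evalPlace (Fp L) L (IsCMField.complexConj L) N H v
                (UnitaryGroup.finPart (Fp L) L (IsCMField.complexConj L) N H k) ∈
              UnitaryGroup.localInt L (IsCMField.complexConj L) N H v) →
            (∀ v ∈ S, UnitaryGroup.evalPlace (Fp L) L (IsCMField.complexConj L) N H v
                (UnitaryGroup.finPart (Fp L) L (IsCMField.complexConj L) N H k) = 1) →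
            quotMatrixCoeff (UnitaryGroup.adelicGroupData (Fp L) L (IsCMField.complexConj L) N H) μ φ₁ φ₂ (t * k) =
              quotMatrixCoeff (UnitaryGroup.adelicGroupData (Fp L) L (IsCMField.complexConj L) N H) μ φ₁ φ₂ t)
          -- (E) local doubling-Hecke identities at every `v ∉ S`, scalar form, all translates
          (_hE : ∀ v, v ∉ S → ∀ t : (UnitaryGroup.adelicGroupData (Fp L) L (IsCMField.complexConj L) N H).Adelic,
            localZeta (νv v) (Λ v)
                (fun g => quotMatrixCoeff (UnitaryGroup.adelicGroupData (Fp L) L (IsCMField.complexConj L) N H) μ φ₁ φ₂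
                  (t * UnitaryGroup.inclPlaceAdelic (Fp L) L (IsCMField.complexConj L) N H v g)) =
              c v * quotMatrixCoeff (UnitaryGroup.adelicGroupData (Fp L) L (IsCMField.complexConj L) N H) μ φ₁ φ₂ t),
          ZetaSConverges L e dV hdV dW hdW H S νinf (fun v : S => νv v.1) μ ιA f φ₁ φ₂ ∧
            doublingZeta L e dV hdV dW hdW (UnitaryGroup.adelicGroupData (Fp L) L (IsCMField.complexConj L) N H) ν μ ιA f φ₁ φ₂ =
              (∏' v : {v : HeightOneSpectrum (𝓞 (Fp L)) // v ∉ S}, c v.1) *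
                zetaS L e dV hdV dW hdW H S νinf (fun v : S => νv v.1) μ ιA f φ₁ φ₂ := by
  intro L _ _ _ N M n e dV hdV dW hdW H S _ _ _ _ _ _ _ ν _ νv _ hνK
  haveI : FirstCountableTopology (UnitaryGroup.adelicGroupData (Fp L) L (IsCMField.complexConj L) N H).Adelic := inferInstanceAs (FirstCountableTopology (UnitaryGroup.adelic (Fp L) L (IsCMField.complexConj L) N H))
  -- (T0) the pinned splitting: the witness `νinf`
  obtain ⟨νinf, hνinf, hσ, hmap⟩ :=
    exists_isHaarMeasure_map_archSplit_eq_prod_pi_rpMeasure (Fp L) L (IsCMField.complexConj L) N H S ν νv hνK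
  haveI := hσ
  refine ⟨νinf, hνinf, fun μ _ _ ιA f φ₁ φ₂ hφ₁ hφ₂ FS Λ c hF hΛK hΛint _ hfc hfi hK hE => ?_⟩
  -- the bounded continuous matrix coefficient (★ (B))
  have hQc := continuous_quotMatrixCoeff (UnitaryGroup.adelicGroupData (Fp L) L (IsCMField.complexConj L) N H) μ hφ₁ hφ₂
  obtain ⟨CQ, hQb⟩ := exists_norm_quotMatrixCoeff_le (UnitaryGroup.adelicGroupData (Fp L) L (IsCMField.complexConj L) N H) μ hφ₁ hφ₂
  have hint : Integrable (fun g => f (iotaLeft L e dV hdV dW hdW (ιA g)) * quotMatrixCoeff (UnitaryGroup.adelicGroupData (Fp L) L (IsCMField.complexConj L) N H) μ φ₁ φ₂ g) ν :=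
    hfi.mul_bdd hQc.aestronglyMeasurable (Eventually.of_forall hQb)
  -- the generic core
  obtain ⟨hconv, hZ⟩ := integrable_and_integral_eq_tprod_mul_of_map_eq (Fp L) L (IsCMField.complexConj L) N H S ν νv hνK νinf hmap
    (fun t => f (iotaLeft L e dV hdV dW hdW (ιA t))) (quotMatrixCoeff (UnitaryGroup.adelicGroupData (Fp L) L (IsCMField.complexConj L) N H) μ φ₁ φ₂) hfc hQc hQb hint hK FS Λ c hF hΛK hΛint
    (fun v hv t => hE v hv t)
  exact ⟨hconv, hZ⟩

end Summit.HodgeConjecture.HodgeConjecture.Cruxes.HLiu418.K2LiuDoublingPartialEuler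

end
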